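import Summits.CriticalPhenomena.PercolationContinuityZ3.Theorems.SahiMasterFamilyKeyStep

/-!
# The principal-cap dichotomy, V: zero families on the principal-cap class are ZERO FLAGS, every order

Support file of the master-family programme (crux `NoHeavyLowerTail`, stmt-CriticalPhenomena-4575; cell `prim-masterthm`, seat P4,
unit `prim-masterthm-p4-g6`).  Seat document HOME/prim-masterthm-p4/P4-GEN6-REPORT.md §4.  Strengthens `SahiMasterFamilyKeyStep.pcd_holds`.

The master equality conjecture (`SahiMasterFamily.MasterFamilyEqIff`) says that the zeros of `E_k` are exactly the ZERO FLAGS (the recursive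
peel class `SahiZeroFlag` / `SuppZeroFlag`).  On the PRINCIPAL-CAP class (`⋂ U_i = ↑c`; ⊇ every tight family) the identically-zero locus is
`Λ(U) = N_{Q(c)}(𝟙) = 0` (`pcd_holds`), and the proof of the key step is itself a peel: so the zero families there are zero flags.

* **`sahiZeroFlag_of_principalCap`**: for every order `n + 1`, every principal-cap family of increasing events with `Λ(U) = 0` and all `w`, `p`,
  the indicator family `(1_{U_0},…,1_{U_n})` is a `SahiZeroFlag` of the sparse product weight `spw w p` — with a slot choice that does NOT depend on
  `w`, `p` (case A: pairwise disjoint cylinders, `sahiZeroFlag_cyl`; case B: delete a slot whose singleton block is not good, `exists_principalCap_delete`,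
  and recurse on the deleted family and on the modified families `V_l`, whose `Λ` vanish by `lambdaSys_eq_sum_peelFam`).
* `principalCap_zero_tfae`-style corollaries: on the principal-cap class `(∀ w p, zero flag) ⟺ (∀ w p, E = 0) ⟺ Λ(U) = 0`
  (`forall_sahiZeroFlag_iff_lambdaSys_eq_zero`).
HONEST FRAMING: the `⇒` direction of the equality conjecture in its IDENTICALLY-ZERO form, on the principal-cap class only (off it, the
bottom-invisible families — OR-triangle, bowties — are not covered); Sahi `C_k` [Sahi2008, Conj. 5] / Kahn Conj. 5 / the master theorem remain
OPEN.  [this work]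
-/

namespace Summit.CriticalPhenomena.PercolationContinuityZ3.Theorems

namespace SahiSparseEnd

open Finset Function SahiRepresentativeForm
open Literature.Combinatorics.Sahi2008

universe u

/-- **ZERO FAMILIES ON THE PRINCIPAL-CAP CLASS ARE ZERO FLAGS, EVERY ORDER.**  For a principal-cap family of `n + 1` increasing events
(up-closed, `∅ ∉ U_i`, `⋂ U_i = ↑c`) with `Λ(U) = 0`, the indicator family is a `SahiZeroFlag` of `spw w p` for all `w`, `p`. [this work] -/
theorem sahiZeroFlag_of_principalCap : ∀ (n : ℕ) {ι : Type u} [Fintype ι] [DecidableEq ι] (U : Fin (n + 1) → Finset (Finset ι))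
    (c : Finset ι), (∀ i a a', a ∈ U i → a ⊆ a' → a' ∈ U i) → (∀ i, ∅ ∉ U i) → IsPrincipalCap U c → LambdaSys (Fc U c) c = 0 →
    ∀ (w : ι → ℝ) (p : ℝ), SahiZeroFlag (spw w p) (n + 1) (fun i => setInd (U i))
  | 0, ι, _, _, U, c, _, _, hpc, hΛ, _, _ => by
    -- order one: `Λ = 1`, the hypothesis is contradictory
    exfalso
    have hc : c ∈ Fc U c 0 := mem_filter.2 ⟨(hpc c).2 subset_rfl 0, subset_rfl⟩
    have h1 := lambdaSys_fin_one (Fc U c) c hc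
    rw [hΛ] at h1
    exact zero_ne_one h1
  | 1, ι, _, _, U, c, hU, h0, hpc, hΛ, w, p => by
    -- order two: a zero flag is just `E_2 = 0`
    show sahiE (spw w p) 2 _ = 0
    exact pcd_holds 1 ι U c hU h0 hpc hΛ w p
  | n + 2, ι, _, _, U, c, hU, h0, hpc, hΛ, w, p => by
    by_cases hall : ∀ j, ({j} : Finset (Fin (n + 3))) ∈ goodBlocks (Fc U c) c
    · -- case A: pairwise disjoint cylinders
      have hupF := Fc_upClosed (c := c) hU
      have hcapF := Fc_cap_of_principalCap hpc
      have hQ : ∀ A ∈ goodBlocks (Fc U c) c, ∀ B ∈ goodBlocks (Fc U c) c, A ∪ B ∈ goodBlocks (Fc U c) c :=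
        fun A hA B hB => goodBlocks_union hupF hA hB
      have herase : ∀ j : Fin (n + 3), univ.erase j ∈ goodBlocks (Fc U c) c := by
        intro j
        have hne : (univ.erase j : Finset (Fin (n + 3))).Nonempty := card_pos.1 (by
          rw [card_erase_of_mem (mem_univ j), Finset.card_univ, Fintype.card_fin]; omega)
        have h := biUnion_mem_of_unionClosed hQ ((univ.erase j).image fun l => ({l} : Finset (Fin (n + 3))))
          (fun A hA => by obtain ⟨l, -, rfl⟩ := mem_image.1 hA; exact hall l) (hne.image _)
        have heq : ((univ.erase j).image fun l => ({l} : Finset (Fin (n + 3)))).biUnion id = univ.erase j := by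
          ext l; simp
        rwa [heq] at h
      have hst := fun j => core_erase_of_good hupF hcapF (herase j)
      have hcyl : (fun i => setInd (U i)) = fun i => setInd (univ.filter fun ω => core (Fc U c) c {i} ⊆ ω) := by
        funext j
        rw [eq_cyl_of_principal hU hpc j (hst j).2.1 ((mem_FR.1 (mem_goodBlocks.1 (hall j)).2.1).2 j (mem_singleton_self j))]
      rw [hcyl]
      exact sahiZeroFlag_cyl w p _ _ fun l j hlj => (hst j).2.2 l hlj
    · -- case B: delete a slot whose singleton block is not good, and recurse
      push Not at hall
      obtain ⟨i, hi⟩ := hall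
      obtain ⟨c', hpc', hΛ'⟩ := exists_principalCap_delete hU h0 hpc hΛ i hi
      have hdelZF : ∀ (w' : ι → ℝ) (q : ℝ), SahiZeroFlag (spw w' q) (n + 2) (fun j => setInd (U (i.succAbove j))) :=
        fun w' q => sahiZeroFlag_of_principalCap (n + 1) (fun j => U (i.succAbove j)) c' (fun j => hU _) (fun j => h0 _) hpc' hΛ' w' q
      have hdel : ∀ q : ℝ, sahiE (spw (fun _ => (1 : ℝ)) q) (n + 2) (fun j => setInd (U (i.succAbove j))) = 0 :=
        fun q => sahiE_eq_zero_of_sahiZeroFlag _ _ _ (hdelZF _ q)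
      -- `Λ(U) = Σ_l Λ(V_l)`, all terms `≥ 0`, so every `Λ(V_l) = 0`
      have hsum := lambdaSys_eq_sum_peelFam hU h0 hpc hdel
      rw [hΛ, Int.cast_zero] at hsum
      have hVU : ∀ l, ∀ j a a', a ∈ peelFam U i l j → a ⊆ a' → a' ∈ peelFam U i l j := fun l => peelFam_up hU l
      have hV0 : ∀ l j, ∅ ∉ peelFam U i l j := fun l => peelFam_empty_not_mem h0 l
      have hVpc : ∀ l, IsPrincipalCap (peelFam U i l) c := fun l => peelFam_principalCap hpc l
      have hnn : ∀ l ∈ (univ : Finset (Fin (n + 2))), (0 : ℝ) ≤ (LambdaSys (Fc (peelFam U i l) c) c : ℝ) := fun l _ =>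
        Int.cast_nonneg (lambdaSys_Fc_nonneg (peelFam U i l) (hVU l) (hV0 l) ⟨c, (hVpc l).self_mem_common⟩
          ((hVpc l).mem_commonMin _))
      have hzero := (sum_eq_zero_iff_of_nonneg hnn).1 hsum.symm
      refine ⟨i, hdelZF w p, fun l => ?_⟩
      rw [update_setInd_eq_peelFam]
      exact sahiZeroFlag_of_principalCap (n + 1) (peelFam U i l) c (hVU l) (hV0 l) (hVpc l)
        (by exact_mod_cast hzero l (mem_univ l)) w p

/-- **On the principal-cap class: zero flag for all weights ⟺ identically zero ⟺ `Λ(U) = 0`.** [this work] -/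
theorem forall_sahiZeroFlag_iff_lambdaSys_eq_zero {ι : Type u} [Fintype ι] [DecidableEq ι] {n : ℕ}
    (U : Fin (n + 1) → Finset (Finset ι)) (c : Finset ι) (hU : ∀ i a a', a ∈ U i → a ⊆ a' → a' ∈ U i) (h0 : ∀ i, ∅ ∉ U i)
    (hpc : IsPrincipalCap U c) :
    (∀ (w : ι → ℝ) (p : ℝ), SahiZeroFlag (spw w p) (n + 1) (fun i => setInd (U i))) ↔ LambdaSys (Fc U c) c = 0 :=
  ⟨fun h => lambdaSys_eq_zero_of_forall_sahiE_eq_zero U hU h0 hpc fun p => sahiE_eq_zero_of_sahiZeroFlag _ _ _ (h _ p),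
    fun h w p => sahiZeroFlag_of_principalCap n U c hU h0 hpc h w p⟩

/-- The same with the identically-zero condition in the middle: `(∀ w p, zero flag) ⟺ (∀ w p, E = 0)`. [this work] -/
theorem forall_sahiZeroFlag_iff_forall_sahiE_eq_zero {ι : Type u} [Fintype ι] [DecidableEq ι] {n : ℕ}
    (U : Fin (n + 1) → Finset (Finset ι)) (c : Finset ι) (hU : ∀ i a a', a ∈ U i → a ⊆ a' → a' ∈ U i) (h0 : ∀ i, ∅ ∉ U i)
    (hpc : IsPrincipalCap U c) :
    (∀ (w : ι → ℝ) (p : ℝ), SahiZeroFlag (spw w p) (n + 1) (fun i => setInd (U i))) ↔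
      ∀ (w : ι → ℝ) (p : ℝ), sahiE (spw w p) (n + 1) (fun i => setInd (U i)) = 0 := by
  rw [forall_sahiZeroFlag_iff_lambdaSys_eq_zero U c hU h0 hpc, forall_sahiE_eq_zero_iff_lambdaSys_eq_zero U c hU h0 hpc]

end SahiSparseEnd

end Summit.CriticalPhenomena.PercolationContinuityZ3.Theorems
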